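import Mathlib
import Summits.KontsevichZagierPeriods.Zeta5Search.PalindromicWBound
import Summits.KontsevichZagierPeriods.Zeta5Search.FloorInequalityWProof
import Summits.KontsevichZagierPeriods.Zeta5Search.WrappedDivisibilityWProof
import HarnessLib

/-!
# ζ(5) search — (WV): the OBSERVED valuation law of the ζ(3)-coefficient IS A THEOREM in the window `p² > b₀ + 2`

Cell `pub-zeta5` (HONEST FRAMING: systematic search; no irrationality claim unless certified), typer seat
generation 9.  Gen-2 g5's OBSERVED law (WV) — `Zeta3CoefficientValuationLaw` of `Zeta5Search/CasoratianValuation.lean`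
(`v_p(W(b)) ≥ law_W = min(1,⌊(d+1)/p⌋) + a_p(b) − N_p(b)`, 0 violations in > 30,000 exact rows; stated there for EVERY prime
`p ≥ 5`) — is proved for every prime of the window `p² > b₀ + 2`:

* `zeta3CoefficientValuationLaw_window : InPolytope b → p.Prime → 5 ≤ p → b₀ + 2 < p² → W(b) ≠ 0 → law_W(b,p) ≤ v_p(W(b))`.

This is gen-2 g6's programme "(WV) = Theorems A/A′/B/C + (T1)" (REPORT-gen2-g6 §5, g7 §1) carried out in the tree:
if `H(3)` holds, Theorem C (`wrappedDivisibilityW_holds`, typer g8) gives `v(W) ≥ [p ≤ d+1] ≥ law_W` (`a_p ≤ N_p`); if `H(3)` fails,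
`law_W ≤ 0` (Step 1) and `law_W ≤ T_x(3)` for every class with a pole of order `≥ 3` (`floorInequalityW_holds`, typer g9), while
`W = Σ_x W_x` with `W_x = 0` for classes without such a pole, `v(W_x) ≥ 0` for single-pole classes (Theorem A′) and
`v(W_x) ≥ T_x(3)` for multipole classes — Theorem A plus the PALINDROME BONUS (`padicNorm_classW_le_classBound`: P1 g5's universal
digit `wDigit` and the palindrome lemma `wHat_eq_zero_of_palindromic`, typer g9).  The range `p² ≤ b₀ + 2` stays OBSERVED.
`p`-adic valuations of rational numbers; no margin of NEAR-MISSES moves; nothing about irrationality.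
-/

noncomputable section

open Finset

namespace Summit.KontsevichZagierPeriods.Zeta5Search.ClusterValuation

open Summit.KontsevichZagierPeriods.Zeta5Search.DualSeries (InBox)
open Summit.KontsevichZagierPeriods.Zeta5Search.WedgeDictionary (coeffW pfData dOf)
open Summit.KontsevichZagierPeriods.Zeta5Search.CasoratianValuation (InPolytope pairFloors refundW topPartners
  Zeta3CoefficientValuationLaw)
open Summit.KontsevichZagierPeriods.Zeta5Search.PadicSeries
open Summit.KontsevichZagierPeriods.Zeta5Search.CellA (classW coeffW_eq_sum_classW pfData_eq_zero_of_order_le)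

/-- **(WV) IN THE WINDOW.**  For `b` in the polytope and every prime `p ≥ 5` with `p² > b₀ + 2`:
`v_p(W(b)) ≥ min(1,⌊(d+1)/p⌋) + a_p(b) − N_p(b)`. -/
theorem zeta3CoefficientValuationLaw_window (b : ℕ → ℤ) (p : ℕ) (hb : InPolytope b) (hprime : p.Prime) (hp5 : 5 ≤ p)
    (hwin : (b 0 + 2 : ℤ) < (p : ℤ) ^ 2) (hW : coeffW b ≠ 0) :
    lawW b p ≤ padicValRat p (coeffW b) := by
  haveI : Fact p.Prime := ⟨hprime⟩
  have hp0 : 0 < p := hprime.pos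
  have h0 : 0 ≤ b 0 := hb.1.1
  by_cases hgood : GoodClasses b p 3
  · -- `H(3)`: Theorem C
    have hC := wrappedDivisibilityW_holds b p hb hprime hp5 hwin hgood hW
    have h1 := lawWLeOne_holds b p hb hp5
    by_cases hpd : (p : ℤ) ≤ dOf b + 1
    · rw [if_pos hpd] at hC; linarith
    · rw [if_neg hpd] at hC
      have := lawWNonpos_holds b p hb hp5 (by omega)
      linarith
  · -- `¬H(3)`: classwise, with the floor inequality and the palindrome bonus
    have hlaw0 := lawW_nonpos_of_not_goodClasses b hb hp5 hgood
    have hodd : ¬ 2 ∣ p := by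
      intro h2
      have := (Nat.prime_dvd_prime_iff_eq Nat.prime_two hprime).1 h2
      omega
    -- a multipole class exists, so `p ≤ b₀`
    have hpb : (p : ℤ) ≤ b 0 := by
      unfold GoodClasses at hgood
      push Not at hgood
      obtain ⟨y, _, hcount, _⟩ := hgood
      obtain ⟨u, hu, v, hv, huv⟩ := one_lt_card.1 (by unfold classPoleCount at hcount; omega :
        1 < ((classSet b p y).filter fun s => netExp b s < 0).card)
      have := p_le_of_two_mem b hp0 (mem_filter.1 hu).1 (mem_filter.1 hv).1 huv
      have hb0 : (((b 0).toNat : ℕ) : ℤ) = b 0 := Int.toNat_of_nonneg h0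
      omega
    apply val_ge_of_padicNorm_le hW
    rw [coeffW_eq_sum_classW b hp0]
    refine padicNorm.sum_le' (fun x hx => ?_) (zpow_p_nonneg _)
    have hx' := mem_range.1 hx
    by_cases h3 : HasPoleOfOrder b p x 3
    · have hT := floorInequalityW_holds b p x hb hp5 hodd hpb hwin hgood hx' h3
      rcases Nat.lt_trichotomy (classPoleCount b p x) 1 with hc | hc | hc
      · rw [classW_eq_zero_of_noPole b hb (by omega), padicNorm.zero]; exact zpow_p_nonneg _
      · refine (padicNorm_classW_le_one b hb hp5 hwin hc).trans ?_
        rw [← zpow_zero (p : ℚ)]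
        exact zpow_le_zpow_right₀ one_le_p (by linarith)
      · exact (padicNorm_classW_le_classBound b hb hp5 hwin hx' (by omega)).trans
          (zpow_le_zpow_right₀ one_le_p (by linarith))
    · -- no pole of order `≥ 3` in the class: `W_x = 0`
      have hW0 : classW b p x = 0 := by
        refine sum_eq_zero fun q hq => pfData_eq_zero_of_order_le b hb (le_of_mem_classSet b hq) (by norm_num) ?_
        by_contra hlt
        exact h3 ⟨q, hq, by push_cast at hlt ⊢; omega⟩
      rw [hW0, padicNorm.zero]
      exact zpow_p_nonneg _

/-- The same, spelled with the law's definition (`law_W = refundW + a_p − N_p`, as in `Zeta3CoefficientValuationLaw`). -/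
theorem zeta3Law_window' (b : ℕ → ℤ) (p : ℕ) (hb : InPolytope b) (hprime : p.Prime) (hp5 : 5 ≤ p)
    (hwin : (b 0 + 2 : ℤ) < (p : ℤ) ^ 2) (hW : coeffW b ≠ 0) :
    refundW b p + topPartners b p - pairFloors b p ≤ padicValRat p (coeffW b) :=
  zeta3CoefficientValuationLaw_window b p hb hprime hp5 hwin hW

end Summit.KontsevichZagierPeriods.Zeta5Search.ClusterValuation

end
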